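import Mathlib
import Summits.ValiantsHypothesis.ValiantsHypothesis.Theorems.NewtonUnitEquationsTwoProductsPowerSumCriterion
import Summits.ValiantsHypothesis.ValiantsHypothesis.Theorems.NewtonUnitEquationsTwoProductsFormalLogLinearisationDefs

/-!
# Crux `TwoProducts` (stmt-ValiantsHypothesis-5906), line `formal-log-linearisation`: real-weight toolkit

Helper file for the stubs of the registered line `Cruxes/TwoProducts/Lines/formal-log-linearisation.lean` over the
objects of `Theorems/NewtonUnitEquationsTwoProductsFormalLogLinearisationDefs.lean` (real weights `ξ`, `wt`,
`IsStrictTop`, `logCoeff`, `logDiff`, `logSupport`):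

* weights: `wt_add`, `wt_zero`, `one_le_deg_of_ne_zero`;
* TAMENESS (written inline, no definition): a polynomial is `c`-tame for `ξ` when every support point `p` has
  `c·(p₀+p₁) ≤ −wt ξ p`; a finite set of exponents of negative weight is uniformly tame for some `c > 0`
  (`exists_tame_const`); tameness is preserved by `+ − * • Σ ∏ ^` and by Euler-type operators; tame points have
  negative weight away from `0` (`wt_neg_of_tame`) and bounded total degree at or above any weight level
  (`deg_le_of_tame`);
* the complex Euler derivation of a real weight (`coeff_eulerDerivation_wt`: `coeff q (θ_ξ A) = wt ξ q · coeff q A`;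
  `support_euler_eq`);
* two strict-top transfer principles for real weights: `isStrictTop_congr` (sets agreeing at and above the weight
  of `l`) and `isStrictTop_support_add_iff` (adding a polynomial whose support lies strictly below support points of
  `A`); `below_of_support_mul`;
Consumed by `…FormalLogLinearisationStubLogLinearisation.lean` (STUB 3).  Honest framing: elementary toolkit; the
crux `TwoProducts` is OPEN; nothing here bears on `VP ≠ VNP`.
-/

set_option linter.dupNamespace false

noncomputable section

open scoped BigOperators
open MvPolynomial

namespace Summit.ValiantsHypothesis.ValiantsHypothesis.Theorems.NewtonUnitEquations.TwoProducts.FormalLogLinearisation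

/-! ## Weights and total degree -/

/-- The real weight is additive. [folklore] -/
theorem wt_add (ξ : Fin 2 → ℝ) (p q : Expo) : wt ξ (p + q) = wt ξ p + wt ξ q := by
  simp only [wt, Finsupp.coe_add, Pi.add_apply, Nat.cast_add]
  ring

/-- The real weight of the zero exponent vanishes. [folklore] -/
theorem wt_zero (ξ : Fin 2 → ℝ) : wt ξ 0 = 0 := by
  simp [wt]

/-- A nonzero exponent vector has total degree `≥ 1`. [folklore] -/
theorem one_le_deg_of_ne_zero (p : Expo) (hp : p ≠ 0) : (1 : ℝ) ≤ ((p 0 : ℕ) : ℝ) + ((p 1 : ℕ) : ℝ) := by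
  have h : p 0 ≠ 0 ∨ p 1 ≠ 0 := by
    by_contra h
    push Not at h
    exact hp (by ext i; fin_cases i <;> simp [h.1, h.2])
  rcases h with h | h
  · have h' : (1 : ℝ) ≤ ((p 0 : ℕ) : ℝ) := by exact_mod_cast Nat.one_le_iff_ne_zero.mpr h
    linarith [(Nat.cast_nonneg (p 1) : (0 : ℝ) ≤ ((p 1 : ℕ) : ℝ))]
  · have h' : (1 : ℝ) ≤ ((p 1 : ℕ) : ℝ) := by exact_mod_cast Nat.one_le_iff_ne_zero.mpr h
    linarith [(Nat.cast_nonneg (p 0) : (0 : ℝ) ≤ ((p 0 : ℕ) : ℝ))]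

/-! ## Tame supports

A polynomial is *`c`-tame* for the weight `ξ` (written out inline, no definition) when every support point `p`
satisfies `c · (p₀ + p₁) ≤ −wt ξ p`. For `c > 0` this confines the support to a pointed cone on which `ξ` is
negative away from the origin and on which the total degree is bounded above in terms of the weight. The tails of a
normalised instance are `c`-tame for a suitable `c > 0` depending on the (finitely many) tails and on the valid
weight; tameness is preserved by sums, products, powers, scalars and Euler derivations. -/

/-- A finite set of exponents of negative weight is uniformly tame. [folklore] -/
theorem exists_tame_const (ξ : Fin 2 → ℝ) (T : Finset Expo) (hT : ∀ e ∈ T, wt ξ e < 0) :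
    ∃ c : ℝ, 0 < c ∧ ∀ e ∈ T, c * (((e 0 : ℕ) : ℝ) + ((e 1 : ℕ) : ℝ)) ≤ -wt ξ e := by
  classical
  induction T using Finset.induction_on with
  | empty => exact ⟨1, one_pos, by simp⟩
  | insert a s ha ih =>
    obtain ⟨c, hc, hcs⟩ := ih fun e he => hT e (Finset.mem_insert_of_mem he)
    have ha' : wt ξ a < 0 := hT a (Finset.mem_insert_self a s)
    have hd0 : (0 : ℝ) ≤ ((a 0 : ℕ) : ℝ) + ((a 1 : ℕ) : ℝ) := by positivity
    rcases hd0.eq_or_lt with hd | hd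
    · refine ⟨c, hc, fun e he => ?_⟩
      rcases Finset.mem_insert.mp he with rfl | he
      · rw [← hd, mul_zero]
        linarith
      · exact hcs e he
    · refine ⟨min c (-wt ξ a / (((a 0 : ℕ) : ℝ) + ((a 1 : ℕ) : ℝ))),
        lt_min hc (div_pos (by linarith) hd), fun e he => ?_⟩
      rcases Finset.mem_insert.mp he with rfl | he
      · calc min c (-wt ξ e / (((e 0 : ℕ) : ℝ) + ((e 1 : ℕ) : ℝ))) * (((e 0 : ℕ) : ℝ) + ((e 1 : ℕ) : ℝ))
            ≤ (-wt ξ e / (((e 0 : ℕ) : ℝ) + ((e 1 : ℕ) : ℝ))) * (((e 0 : ℕ) : ℝ) + ((e 1 : ℕ) : ℝ)) :=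
              mul_le_mul_of_nonneg_right (min_le_right _ _) hd.le
          _ = -wt ξ e := div_mul_cancel₀ _ hd.ne'
      · calc min c (-wt ξ a / (((a 0 : ℕ) : ℝ) + ((a 1 : ℕ) : ℝ))) * (((e 0 : ℕ) : ℝ) + ((e 1 : ℕ) : ℝ))
            ≤ c * (((e 0 : ℕ) : ℝ) + ((e 1 : ℕ) : ℝ)) :=
              mul_le_mul_of_nonneg_right (min_le_left _ _) (by positivity)
          _ ≤ -wt ξ e := hcs e he

section Tame

variable (ξ : Fin 2 → ℝ) (c : ℝ)

/-- Tame exponents have negative weight away from the origin. [folklore] -/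
theorem wt_neg_of_tame {ξ : Fin 2 → ℝ} {c : ℝ} (hc : 0 < c) {p : Expo}
    (hp : c * (((p 0 : ℕ) : ℝ) + ((p 1 : ℕ) : ℝ)) ≤ -wt ξ p) (hp0 : p ≠ 0) : wt ξ p < 0 := by
  have h1 := one_le_deg_of_ne_zero p hp0
  nlinarith

/-- Tame exponents above a weight level have bounded total degree. [folklore] -/
theorem deg_le_of_tame {ξ : Fin 2 → ℝ} {c : ℝ} (hc : 0 < c) {p : Expo}
    (hp : c * (((p 0 : ℕ) : ℝ) + ((p 1 : ℕ) : ℝ)) ≤ -wt ξ p) {W : ℝ} (hW : W ≤ wt ξ p) :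
    ((p 0 : ℕ) : ℝ) + ((p 1 : ℕ) : ℝ) ≤ -W / c := by
  rw [le_div_iff₀ hc]
  linarith

/-- Tameness of exponents is additive. [folklore] -/
theorem tame_add_expo {p q : Expo} (hp : c * (((p 0 : ℕ) : ℝ) + ((p 1 : ℕ) : ℝ)) ≤ -wt ξ p)
    (hq : c * (((q 0 : ℕ) : ℝ) + ((q 1 : ℕ) : ℝ)) ≤ -wt ξ q) :
    c * ((((p + q) 0 : ℕ) : ℝ) + (((p + q) 1 : ℕ) : ℝ)) ≤ -wt ξ (p + q) := by
  simp only [wt_add, Finsupp.coe_add, Pi.add_apply, Nat.cast_add]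
  linarith

/-- `1` is tame. [folklore] -/
theorem tame_one : ∀ p ∈ (1 : MvPolynomial (Fin 2) ℂ).support,
    c * (((p 0 : ℕ) : ℝ) + ((p 1 : ℕ) : ℝ)) ≤ -wt ξ p := by
  intro p hp
  rw [support_one, Finset.mem_singleton] at hp
  subst hp
  simp [wt_zero]

/-- Sums of tame polynomials are tame. [folklore] -/
theorem tame_add {A B : MvPolynomial (Fin 2) ℂ}
    (hA : ∀ p ∈ A.support, c * (((p 0 : ℕ) : ℝ) + ((p 1 : ℕ) : ℝ)) ≤ -wt ξ p)
    (hB : ∀ p ∈ B.support, c * (((p 0 : ℕ) : ℝ) + ((p 1 : ℕ) : ℝ)) ≤ -wt ξ p) :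
    ∀ p ∈ (A + B).support, c * (((p 0 : ℕ) : ℝ) + ((p 1 : ℕ) : ℝ)) ≤ -wt ξ p := by
  classical
  intro p hp
  rcases Finset.mem_union.mp (support_add hp) with h | h
  · exact hA p h
  · exact hB p h

/-- Differences of tame polynomials are tame. [folklore] -/
theorem tame_sub {A B : MvPolynomial (Fin 2) ℂ}
    (hA : ∀ p ∈ A.support, c * (((p 0 : ℕ) : ℝ) + ((p 1 : ℕ) : ℝ)) ≤ -wt ξ p)
    (hB : ∀ p ∈ B.support, c * (((p 0 : ℕ) : ℝ) + ((p 1 : ℕ) : ℝ)) ≤ -wt ξ p) :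
    ∀ p ∈ (A - B).support, c * (((p 0 : ℕ) : ℝ) + ((p 1 : ℕ) : ℝ)) ≤ -wt ξ p := by
  classical
  intro p hp
  rcases Finset.mem_union.mp (support_sub _ _ _ hp) with h | h
  · exact hA p h
  · exact hB p h

/-- Products of tame polynomials are tame. [folklore] -/
theorem tame_mul {A B : MvPolynomial (Fin 2) ℂ}
    (hA : ∀ p ∈ A.support, c * (((p 0 : ℕ) : ℝ) + ((p 1 : ℕ) : ℝ)) ≤ -wt ξ p)
    (hB : ∀ p ∈ B.support, c * (((p 0 : ℕ) : ℝ) + ((p 1 : ℕ) : ℝ)) ≤ -wt ξ p) :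
    ∀ p ∈ (A * B).support, c * (((p 0 : ℕ) : ℝ) + ((p 1 : ℕ) : ℝ)) ≤ -wt ξ p := by
  classical
  intro p hp
  obtain ⟨a, ha, b, hb, rfl⟩ := Finset.mem_add.mp (support_mul _ _ hp)
  exact tame_add_expo ξ c (hA a ha) (hB b hb)

/-- Scalar multiples of tame polynomials are tame. [folklore] -/
theorem tame_smul (a : ℂ) {A : MvPolynomial (Fin 2) ℂ}
    (hA : ∀ p ∈ A.support, c * (((p 0 : ℕ) : ℝ) + ((p 1 : ℕ) : ℝ)) ≤ -wt ξ p) :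
    ∀ p ∈ (a • A).support, c * (((p 0 : ℕ) : ℝ) + ((p 1 : ℕ) : ℝ)) ≤ -wt ξ p :=
  fun p hp => hA p (support_smul hp)

/-- Finite sums of tame polynomials are tame. [folklore] -/
theorem tame_sum {ι : Type*} (s : Finset ι) {f : ι → MvPolynomial (Fin 2) ℂ}
    (hf : ∀ i ∈ s, ∀ p ∈ (f i).support, c * (((p 0 : ℕ) : ℝ) + ((p 1 : ℕ) : ℝ)) ≤ -wt ξ p) :
    ∀ p ∈ (∑ i ∈ s, f i).support, c * (((p 0 : ℕ) : ℝ) + ((p 1 : ℕ) : ℝ)) ≤ -wt ξ p := by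
  classical
  induction s using Finset.induction_on with
  | empty => simp
  | insert a s ha ih =>
    rw [Finset.sum_insert ha]
    exact tame_add ξ c (hf a (Finset.mem_insert_self a s))
      (ih fun i hi => hf i (Finset.mem_insert_of_mem hi))

/-- Finite products of tame polynomials are tame. [folklore] -/
theorem tame_prod {ι : Type*} (s : Finset ι) {f : ι → MvPolynomial (Fin 2) ℂ}
    (hf : ∀ i ∈ s, ∀ p ∈ (f i).support, c * (((p 0 : ℕ) : ℝ) + ((p 1 : ℕ) : ℝ)) ≤ -wt ξ p) :
    ∀ p ∈ (∏ i ∈ s, f i).support, c * (((p 0 : ℕ) : ℝ) + ((p 1 : ℕ) : ℝ)) ≤ -wt ξ p := by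
  classical
  induction s using Finset.induction_on with
  | empty => simpa using tame_one ξ c
  | insert a s ha ih =>
    rw [Finset.prod_insert ha]
    exact tame_mul ξ c (hf a (Finset.mem_insert_self a s))
      (ih fun i hi => hf i (Finset.mem_insert_of_mem hi))

/-- Powers of tame polynomials are tame. [folklore] -/
theorem tame_pow {A : MvPolynomial (Fin 2) ℂ}
    (hA : ∀ p ∈ A.support, c * (((p 0 : ℕ) : ℝ) + ((p 1 : ℕ) : ℝ)) ≤ -wt ξ p) (r : ℕ) :
    ∀ p ∈ (A ^ r).support, c * (((p 0 : ℕ) : ℝ) + ((p 1 : ℕ) : ℝ)) ≤ -wt ξ p := by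
  induction r with
  | zero => simpa using tame_one ξ c
  | succ r ih =>
    rw [pow_succ]
    exact tame_mul ξ c ih hA

end Tame

/-! ## The Euler derivation of a real weight -/

/-- One summand of the Euler derivation on a monomial (complex scalars). [folklore] -/
theorem monomial_tsub_smul_cX (a : Fin 2 → ℂ) (s : Expo) (i : Fin 2) :
    (monomial (s - Finsupp.single i 1) ((s i : ℕ) : ℂ) : MvPolynomial (Fin 2) ℂ) •
        ((a i) • (X i : MvPolynomial (Fin 2) ℂ)) =
      ((a i) * ((s i : ℕ) : ℂ)) • monomial s (1 : ℂ) := by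
  rw [smul_eq_mul, mul_smul_comm, mul_smul]
  congr 1
  by_cases h : s i = 0
  · simp [h]
  · rw [X, monomial_mul, mul_one,
      tsub_add_cancel_of_le (Finsupp.single_le_iff.mpr (Nat.one_le_iff_ne_zero.mpr h)),
      smul_monomial, smul_eq_mul, mul_one]

/-- Coefficient formula for the Euler derivation `θ_a = ∑ i, a i • X i ∂_i` with complex scalars:
`coeff q (θ_a A) = (a 0 * q 0 + a 1 * q 1) * coeff q A`. [folklore] -/
theorem coeff_eulerDerivationC (a : Fin 2 → ℂ) (A : MvPolynomial (Fin 2) ℂ) (q : Expo) :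
    coeff q (MvPolynomial.mkDerivation ℂ (fun i : Fin 2 => (a i) • (X i : MvPolynomial (Fin 2) ℂ)) A) =
      (a 0 * ((q 0 : ℕ) : ℂ) + a 1 * ((q 1 : ℕ) : ℂ)) * coeff q A := by
  induction A using MvPolynomial.induction_on' with
  | monomial s b =>
    rw [MvPolynomial.mkDerivation_monomial, Finsupp.sum_fintype _ _ (fun i => by simp),
      Fin.sum_univ_two, monomial_tsub_smul_cX, monomial_tsub_smul_cX, ← add_smul, smul_smul,
      coeff_smul, coeff_monomial, coeff_monomial]
    split_ifs with h
    · subst h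
      rw [smul_eq_mul]
      ring
    · rw [smul_zero, mul_zero]
  | add p q hp hq => rw [map_add, coeff_add, coeff_add, hp, hq, mul_add]

/-- The Euler derivation of the real weight `ξ` multiplies the coefficient of `X^q` by `wt ξ q`. [folklore] -/
theorem coeff_eulerDerivation_wt (ξ : Fin 2 → ℝ) (A : MvPolynomial (Fin 2) ℂ) (q : Expo) :
    coeff q (MvPolynomial.mkDerivation ℂ
        (fun i : Fin 2 => ((ξ i : ℝ) : ℂ) • (X i : MvPolynomial (Fin 2) ℂ)) A) =
      ((wt ξ q : ℝ) : ℂ) * coeff q A := by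
  rw [coeff_eulerDerivationC]
  simp only [wt, Complex.ofReal_add, Complex.ofReal_mul, Complex.ofReal_natCast]

/-- An Euler-type operator does not enlarge supports (hence preserves tameness). [folklore] -/
theorem tame_euler (ξ : Fin 2 → ℝ) (c : ℝ) {A T : MvPolynomial (Fin 2) ℂ}
    (hT : ∀ q, coeff q T = ((wt ξ q : ℝ) : ℂ) * coeff q A)
    (hA : ∀ p ∈ A.support, c * (((p 0 : ℕ) : ℝ) + ((p 1 : ℕ) : ℝ)) ≤ -wt ξ p) :
    ∀ p ∈ T.support, c * (((p 0 : ℕ) : ℝ) + ((p 1 : ℕ) : ℝ)) ≤ -wt ξ p := by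
  intro p hp
  refine hA p ?_
  rw [mem_support_iff] at hp ⊢
  exact right_ne_zero_of_mul (hT p ▸ hp)

/-- For a constant-free tame `A`, an Euler-type image `T` has the same support (the weight is nonzero on the
support). [folklore] -/
theorem support_euler_eq (ξ : Fin 2 → ℝ) {c : ℝ} (hc : 0 < c) {A T : MvPolynomial (Fin 2) ℂ}
    (hT : ∀ q, coeff q T = ((wt ξ q : ℝ) : ℂ) * coeff q A) (hA0 : coeff 0 A = 0)
    (hA : ∀ p ∈ A.support, c * (((p 0 : ℕ) : ℝ) + ((p 1 : ℕ) : ℝ)) ≤ -wt ξ p) :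
    T.support = A.support := by
  ext p
  rw [mem_support_iff, mem_support_iff, hT p]
  refine ⟨right_ne_zero_of_mul, fun h => mul_ne_zero ?_ h⟩
  have hp0 : p ≠ 0 := by rintro rfl; exact h hA0
  have hneg := wt_neg_of_tame hc (hA p (mem_support_iff.mpr h)) hp0
  exact_mod_cast hneg.ne

/-! ## Strict tops: two transfer principles -/

/-- Two sets that agree at and above the weight of `l` have the same strict `ξ`-top status at `l`. [folklore] -/
theorem isStrictTop_congr (ξ : Fin 2 → ℝ) {S T : Set Expo} {l : Expo}
    (h : ∀ p, wt ξ l ≤ wt ξ p → (p ∈ S ↔ p ∈ T)) : IsStrictTop ξ S l ↔ IsStrictTop ξ T l := by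
  constructor
  · rintro ⟨hl, hmin⟩
    refine ⟨(h l le_rfl).mp hl, fun μ hμ hne => ?_⟩
    by_contra hlt
    exact hlt (hmin μ ((h μ (not_lt.mp hlt)).mpr hμ) hne)
  · rintro ⟨hl, hmin⟩
    refine ⟨(h l le_rfl).mpr hl, fun μ hμ hne => ?_⟩
    by_contra hlt
    exact hlt (hmin μ ((h μ (not_lt.mp hlt)).mp hμ) hne)

/-- Adding a polynomial every support point of which lies STRICTLY BELOW some support point of `A` does not change
the strict `ξ`-top (the top layer of `A + C` is the top layer of `A`). [folklore] -/
theorem isStrictTop_support_add_iff (ξ : Fin 2 → ℝ) (A C : MvPolynomial (Fin 2) ℂ)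
    (h : ∀ p ∈ C.support, ∃ q ∈ A.support, wt ξ p < wt ξ q) (l : Expo) :
    IsStrictTop ξ ↑(A + C).support l ↔ IsStrictTop ξ ↑A.support l := by
  classical
  have hC_of_max : ∀ p ∈ A.support, (∀ q ∈ A.support, wt ξ q ≤ wt ξ p) → coeff p C = 0 := by
    intro p _ hmax
    by_contra hne
    obtain ⟨q, hq, hlt⟩ := h p (mem_support_iff.mpr hne)
    exact absurd (hmax q hq) (not_le.mpr hlt)
  have hmem_of_max : ∀ p ∈ A.support, (∀ q ∈ A.support, wt ξ q ≤ wt ξ p) → p ∈ (A + C).support := by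
    intro p hp hmax
    rw [mem_support_iff, coeff_add, hC_of_max p hp hmax, add_zero]
    exact mem_support_iff.mp hp
  constructor
  · rintro ⟨hl, hmin⟩
    have hl' : l ∈ (A + C).support := hl
    have hAne : A.support.Nonempty := by
      rcases Finset.mem_union.mp (support_add hl') with hA | hC
      · exact ⟨l, hA⟩
      · obtain ⟨q, hq, -⟩ := h l hC
        exact ⟨q, hq⟩
    obtain ⟨p₀, hp₀, hp₀max⟩ := Finset.exists_max_image A.support (wt ξ) hAne
    have hp₀S : p₀ ∈ (A + C).support := hmem_of_max p₀ hp₀ hp₀max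
    have hle : wt ξ l ≤ wt ξ p₀ := by
      rcases Finset.mem_union.mp (support_add hl') with hA | hC
      · exact hp₀max l hA
      · obtain ⟨q, hq, hlt⟩ := h l hC
        exact hlt.le.trans (hp₀max q hq)
    have hl0 : l = p₀ := by
      by_contra hne
      exact absurd (hmin p₀ hp₀S (Ne.symm hne)) (not_lt.mpr hle)
    subst hl0
    refine ⟨hp₀, fun μ hμ hne => ?_⟩
    rcases (hp₀max μ hμ).lt_or_eq with hlt | heq
    · exact hlt
    · exact hmin μ (hmem_of_max μ hμ fun q hq => heq ▸ hp₀max q hq) hne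
  · rintro ⟨hl, hmin⟩
    have hl' : l ∈ A.support := hl
    have hlmax : ∀ q ∈ A.support, wt ξ q ≤ wt ξ l := fun q hq =>
      (eq_or_ne q l).elim (fun h => h ▸ le_rfl) fun hne => (hmin q hq hne).le
    refine ⟨hmem_of_max l hl' hlmax, fun μ hμ hne => ?_⟩
    rcases Finset.mem_union.mp (support_add hμ) with hA | hC
    · exact hmin μ hA hne
    · obtain ⟨q, hq, hlt⟩ := h μ hC
      exact lt_of_lt_of_le hlt (hlmax q hq)

/-- Support points of `A * B`, for `B` constant-free and tame, lie strictly below support points of `A`.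
[folklore] -/
theorem below_of_support_mul (ξ : Fin 2 → ℝ) {c : ℝ} (hc : 0 < c) (A B : MvPolynomial (Fin 2) ℂ)
    (hB0 : coeff 0 B = 0) (hB : ∀ p ∈ B.support, c * (((p 0 : ℕ) : ℝ) + ((p 1 : ℕ) : ℝ)) ≤ -wt ξ p) :
    ∀ p ∈ (A * B).support, ∃ q ∈ A.support, wt ξ p < wt ξ q := by
  classical
  intro p hp
  obtain ⟨a, ha, b, hb, rfl⟩ := Finset.mem_add.mp (support_mul _ _ hp)
  refine ⟨a, ha, ?_⟩
  have hb0 : b ≠ 0 := by rintro rfl; exact (mem_support_iff.mp hb) hB0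
  have hneg := wt_neg_of_tame hc (hB b hb) hb0
  rw [wt_add]
  linarith

end Summit.ValiantsHypothesis.ValiantsHypothesis.Theorems.NewtonUnitEquations.TwoProducts.FormalLogLinearisation

end
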